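import Literature.MathematicalPhysics.QuantumFieldTheory.Balaban1983to89.B8TorusShiftAveraging

/-!
# `Balaban1983to89.B8TorusShiftLandau` — translation covariance of the ADJOINT BLOCK AVERAGING `Q′_j(U₀)ᵀ` ([4] (3.19)∕(3.24)) and of the LANDAU
# CONDITION (1.38) «R(U₀)D^{η*}_{U₀}A = 0» in its multiplier form of record `B8Eq138LandauZd.IsLandau138` FOR THE TORUS CONSTRAINT SEQUENCE
# `torusLam k` — module M1b-Q of the periodicity joint of the [B8] §3 Theorem-2 torus supplier (sub-row «G-B8-T2S», `lit-balaban-p33/T2S-MAP.md`)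

statement-level skeleton of published theorems with citation tags; proofs where landed; nothing here is a claim about the
Yang–Mills mass gap

T. Bałaban, *Spaces of regular gauge field configurations on a lattice and gauge fixing conditions*, Commun. Math. Phys. **99** (1985) 75–102
`[Balaban1985RegularSpaces]` ((1.38) p. 82, (1.29) p. 81, p. 77 «Ω_j = T_η»); T. Bałaban, *Propagators for lattice gauge theories in a background field*,
Commun. Math. Phys. **99** (1985) 389–434 `[Balaban1985BackgroundPropagators]` ([4]; (3.19) p. 393, (3.23)–(3.25) p. 394); [Balaban1987RG1] (4.16) p. 285.

CITATION HEADER (lean-in-tree rule).  Cell `lit-balaban`, seat `lit-balaban-p33` (gen 90), sub-row «G-B8-T2S», module M1b-Q.  WHAT IS PROVED (kernel,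
0 sorry, theorems only): `blockMap_add_smul` (the block of `x + Lw` is the block of `x` translated by `w`), `qprimeT1_shiftCfg`, **`QprimeT_shiftCfg`**
(`Q′_j(t_{Lʲw}U₀)ᵀ(t_wν)(x) = (Q′_j(U₀)ᵀν)(x + Lʲw)`, induction on `j`), `indicator_torusLam_shiftCfg`, **`QT_torusLam_shiftCfg`**, and
**`isLandau138_torusLam_shiftCfg`**: (1.38) at `Ω₀ = ℤᵈ`, `Λ = torusLam k` holds for `(t_{Lᵏw}U₀, t_{Lᵏw}A)` whenever it holds for `(U₀, A)` (the
multiplier translated level by level).  Elementary bookkeeping on the tree's concrete objects; nothing of Theorem 2 ∕ [4] is proved here; `T_η ↦ ℤᵈ`;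
count-neutral; nothing continuum ∕ ℝ⁴ ∕ OS ∕ mass-gap ∕ Clay.
-/

noncomputable section

open NormedSpace
open scoped BigOperators

namespace Literature.MathematicalPhysics.QuantumFieldTheory.Balaban1983to89.B8TorusShiftLandau

open Literature.MathematicalPhysics.QuantumLattice (blockMap)
open B7Eq78Linearization (conjR)
open B8Eq119TwistedAxial (bgT)
open B8Eq138LandauZd (IsLandau138 covLap covDivB qprimeT1 QprimeT QT)
open B8Thm4TorusAt (torusLam mem_torusLam_iff torusLam_of_ne torusLam_self)
open B12Ineq417Flat (shiftCfg shiftCfg_apply)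
open B8TorusShiftStencils (covLap_shiftCfg covDivB_shiftCfg)
open B8TorusShiftAveraging (bgT_shiftCfg)

-- the `ℤ^d` sites of `B7Prop1Explicit` are `LSite` here (convention of `B8Thm2TorusAt`).
open B7Prop1Explicit renaming Site → LSite

variable {d : ℕ}

/-- **The block of a translated site**: `blockMap L (x + Lw) = blockMap L x + w` (`L ≥ 1`). [cite: Balaban1985Averaging, (43) p.24 (blocks `B(y)`)] -/
theorem blockMap_add_smul {L : ℕ} (hL : 1 ≤ L) (x w : LSite d) : blockMap L (x + (L : ℤ) • w) = blockMap L x + w := by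
  funext i
  have hL0 : (L : ℤ) ≠ 0 := by exact_mod_cast (Nat.one_le_iff_ne_zero.1 hL)
  simp only [blockMap, Pi.add_apply, Pi.smul_apply, smul_eq_mul]
  rw [mul_comm, Int.add_mul_ediv_right _ _ hL0]

section Adjoint

variable {𝔸 : Type*} [NormedRing 𝔸] [NormedAlgebra ℂ 𝔸] [CompleteSpace 𝔸]

/-- **One step of `Q′ᵀ` for translated data**: `(step_j(t_{Lʲ(Lw)}U₀))ᵀ(t_wν)(x) = (step_j(U₀))ᵀν (x + Lw)`.
[cite: Balaban1985BackgroundPropagators, (3.19) p.393; Balaban1987RG1, (4.16) p.285] -/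
theorem qprimeT1_shiftCfg {L : ℕ} (hL : 1 ≤ L) (U₀ : LSite d → Fin d → 𝔸ˣ) (j : ℕ) (w : LSite d) (ν : LSite d → 𝔸) (x : LSite d) :
    qprimeT1 L (shiftCfg (((L : ℤ) ^ j) • ((L : ℤ) • w)) U₀) j (shiftCfg w ν) x = qprimeT1 L U₀ j ν (x + (L : ℤ) • w) := by
  unfold qprimeT1
  rw [bgT_shiftCfg, blockMap_add_smul hL, shiftCfg_apply]

/-- **`Q′_j(U₀)ᵀ` OF TRANSLATED DATA**: `Q′_j(t_{Lʲw}U₀)ᵀ(t_wν)(x) = (Q′_j(U₀)ᵀν)(x + Lʲw)` — translating the background on the fine lattice by `Lʲw`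
and the level-`j` multiplier by `w` translates the transpose averaging by `Lʲw`. [cite: Balaban1985BackgroundPropagators, (3.19) p.393, (3.24) p.394; Balaban1987RG1, (4.16) p.285] -/
theorem QprimeT_shiftCfg {L : ℕ} (hL : 1 ≤ L) (U₀ : LSite d → Fin d → 𝔸ˣ) :
    ∀ (j : ℕ) (w : LSite d) (ν : LSite d → 𝔸) (x : LSite d),
      QprimeT L (shiftCfg (((L : ℤ) ^ j) • w) U₀) j (shiftCfg w ν) x = QprimeT L U₀ j ν (x + ((L : ℤ) ^ j) • w)
  | 0, w, ν, x => by simp [QprimeT, shiftCfg_apply]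
  | j + 1, w, ν, x => by
      have hv : ((L : ℤ) ^ (j + 1)) • w = ((L : ℤ) ^ j) • ((L : ℤ) • w) := by rw [pow_succ, mul_smul]
      rw [hv]
      show QprimeT L (shiftCfg (((L : ℤ) ^ j) • ((L : ℤ) • w)) U₀) j
          (qprimeT1 L (shiftCfg (((L : ℤ) ^ j) • ((L : ℤ) • w)) U₀) j (shiftCfg w ν)) x =
        QprimeT L U₀ j (qprimeT1 L U₀ j ν) (x + ((L : ℤ) ^ j) • ((L : ℤ) • w))
      have h1 : qprimeT1 L (shiftCfg (((L : ℤ) ^ j) • ((L : ℤ) • w)) U₀) j (shiftCfg w ν) = shiftCfg ((L : ℤ) • w) (qprimeT1 L U₀ j ν) := by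
        funext x'
        rw [qprimeT1_shiftCfg hL, shiftCfg_apply]
      rw [h1, QprimeT_shiftCfg hL U₀ j ((L : ℤ) • w) (qprimeT1 L U₀ j ν) x]

omit [NormedAlgebra ℂ 𝔸] [CompleteSpace 𝔸] in
/-- The torus constraint sets are `∅` or `ℤᵈ`, so restriction to them commutes with translations. [cite: Balaban1985RegularSpaces, (1.28) p.81, p.77 («Ω_j = T_η»)] -/
theorem indicator_torusLam_shiftCfg (k j : ℕ) (w : LSite d) (f : LSite d → 𝔸) :
    (torusLam (d := d) k j).indicator (shiftCfg w f) = shiftCfg w ((torusLam (d := d) k j).indicator f) := by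
  by_cases h : j = k
  · subst h; funext x; simp [torusLam, shiftCfg_apply]
  · funext x; simp [torusLam_of_ne h, shiftCfg_apply]

/-- **`Q′(U₀)ᵀμ` ON `𝔅_k` FOR `Λ = torusLam k`, TRANSLATED**: with the multiplier translated level by level (`μ′_j = t_{L^{k−j}w}μ_j`),
`Q′(t_{Lᵏw}U₀)ᵀμ′(x) = (Q′(U₀)ᵀμ)(x + Lᵏw)`. [cite: Balaban1985BackgroundPropagators, (3.24) p.394; Balaban1985RegularSpaces, (1.29) p.81, p.77 («Ω_j = T_η»)] -/
theorem QT_torusLam_shiftCfg {L : ℕ} (hL : 1 ≤ L) (k : ℕ) (U₀ : LSite d → Fin d → 𝔸ˣ) (μ : ℕ → LSite d → 𝔸) (w x : LSite d) :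
    QT L k (torusLam k) (shiftCfg (((L : ℤ) ^ k) • w) U₀) (fun j => shiftCfg (((L : ℤ) ^ (k - j)) • w) (μ j)) x =
      QT L k (torusLam k) U₀ μ (x + ((L : ℤ) ^ k) • w) := by
  unfold QT
  refine Finset.sum_congr rfl fun j hj => ?_
  have hjk : j ≤ k := Nat.lt_succ_iff.1 (Finset.mem_range.1 hj)
  have hw : ((L : ℤ) ^ k) • w = ((L : ℤ) ^ j) • (((L : ℤ) ^ (k - j)) • w) := by
    rw [← mul_smul, ← pow_add, Nat.add_sub_cancel' hjk]
  rw [indicator_torusLam_shiftCfg, hw, QprimeT_shiftCfg hL]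

/-- **(1.38) AT `Ω₀ = ℤᵈ`, `Λ = torusLam k` IS TRANSLATION INVARIANT**: if `R(U₀)D^{η*}_{U₀}A = 0` (multiplier form of record:
`Δ^η_{U₀}(D^{η*}_{U₀}A) = Q′(U₀)ᵀμ` for some level multipliers `μ`), then the same holds for the pair translated by `Lᵏw` on the fine lattice (with the
translated multipliers). [cite: Balaban1985RegularSpaces, (1.38) p.82, p.77 («Ω_j = T_η»); Balaban1985BackgroundPropagators, (3.23)–(3.25) p.394] -/
theorem isLandau138_torusLam_shiftCfg {L : ℕ} (hL : 1 ≤ L) (k : ℕ) (η : ℝ) (U₀ : LSite d → Fin d → 𝔸ˣ) (A : LSite d → Fin d → 𝔸) (w : LSite d)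
    (h : IsLandau138 L k η (Set.univ : Set (LSite d)) (torusLam k) U₀ A) :
    IsLandau138 L k η (Set.univ : Set (LSite d)) (torusLam k) (shiftCfg (((L : ℤ) ^ k) • w) U₀) (shiftCfg (((L : ℤ) ^ k) • w) A) := by
  obtain ⟨μ, hμ⟩ := h
  refine ⟨fun j => shiftCfg (((L : ℤ) ^ (k - j)) • w) (μ j), fun x _ => ?_⟩
  rw [QT_torusLam_shiftCfg hL, Set.indicator_univ, ← hμ (x + ((L : ℤ) ^ k) • w) (Set.mem_univ _), Set.indicator_univ]
  have hc : covDivB η (shiftCfg (((L : ℤ) ^ k) • w) U₀) (shiftCfg (((L : ℤ) ^ k) • w) A) = shiftCfg (((L : ℤ) ^ k) • w) (covDivB η U₀ A) := by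
    funext z
    rw [covDivB_shiftCfg, shiftCfg_apply]
  rw [hc, covLap_shiftCfg]

end Adjoint

#print axioms QprimeT_shiftCfg
#print axioms isLandau138_torusLam_shiftCfg

end Literature.MathematicalPhysics.QuantumFieldTheory.Balaban1983to89.B8TorusShiftLandau

end
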